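import Literature.AnabelianGeometry.SemiGraphs.ThetaRayDeepFixedProjection
import Literature.AnabelianGeometry.SemiGraphs.TemperedPiPointSeqThrough
import HarnessLib

/-!
# The escaping procyclic compact of `π₁^temp(𝒢_θ)` is the UNIQUE maximal compact subgroup above each of its
# powers (typed-form audit of [SemiAnbd] Thm 3.7 (iv) clause 2 at `𝒢_θ`, row «B9·ANCHOR-FREE-PAIR», brick K-B4b/3)

Mochizuki, *Semi-graphs of anabelioids*, Publ. RIMS **42** (2006), §3, Theorem 3.7 (iv) p. 41 ("the maximal
compact subgroups … are precisely the verticial subgroups; the intersection of two distinct maximal compact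
subgroups is either trivial or an edge-like subgroup") [cite: MochizukiSemiAnbd2006, Thm 3.7(iv) p.41].

PROOF-ONLY file (abc-iut cell, layer L3, seat abc-iut-L3-d4 gen 5; row «B9·ANCHOR-FREE-PAIR@𝒢_θ» (L3-lead
β50/γ10); frontier / erratum-grade label — typed-form audit of the cell's ∀-countable typing of Thm 3.7 (iv) at
abc-iut-L3-d1's countermodel `𝒢_θ(p,n)`, OUTSIDE the [IUTchIII] Cor. 3.12 cone; 0 definitions, no named fact).
Desk memo `HOME/staging/L3/L3-d4/g5/B9-ANCHOR-FREE-PAIR.md`, steps (S5)/(S6) for pairs through `C`.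

`thetaRayFreeProP_exists_compact_unique_above_powers` — at `𝒢_θ(p,n)` (every schedule `n_k → ∞`) the canonical
`π₁^temp` contains `c` with `C := closure⟨c⟩` COMPACT, lying in NO verticial subgroup, and such that EVERY
compact subgroup `K` containing some power `c^{p^m}` lies in `C`.  Consequences (`m = 0`): `C` is a maximal
compact subgroup (abc-iut-L3-d4 gen 4's EXOTIC-IS-C re-derived); a maximal compact subgroup `K ≠ C` meets `C`
at most in elements that are not powers `c^{p^m}`; in particular the typed clause 2 of Thm 3.7 (iv)
(`MaximalCompactIffVerticialAt`, «`K₁ ⊓ K₂ ≠ 1 ⇒ edge-like`») cannot fail at `𝒢_θ` through a pair `(C, K)`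
sharing a power of `c`.  Assembly: two deep `K`-fixed tree vertices of different heights (compactness, Lemma
1.8 (ii); escape of `c^{p^m}`, p475835) project to DISTINCT `K`-fixed vertices of `𝔾̃_{n₀}` which are ALSO
`ρ_{n₀}(c)`-fixed by (♦) (`ThetaRayDeepFixedProjection`); the first branch of the geodesic between them is fixed
by `K` and by `c`; its stabiliser is cyclic of the order of `ρ_{n₀}(c)` (abc-iut-L3-d3's
`eq_zpowers_of_forall_fix_brOf_of_orderOf_eq`, p477446's `thetaRay_orderOf_gal_brHom_eq_of_far`), so
`ρ_{n₀}(K) ≤ ⟨ρ_{n₀}(c)⟩` for all large `n₀`, whence `K ≤ C`.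

Nothing of [SemiAnbd] is asserted; nothing bears on [IUTchIII] Cor. 3.12; typed ≠ proved.
-/

noncomputable section

namespace Literature.AnabelianGeometry.SemiGraphs

open CategoryTheory Filter Topology Multiplicative
open ProfiniteSemiGraph ProfiniteSemiGraph.GaloisLevelData
open Literature.AnabelianGeometry.SemiGraphs.FreeProPRankTwo

namespace ProfiniteSemiGraph

namespace GaloisLevelData

universe u

variable {𝒢 : ProfiniteSemiGraph.{u}} (D : GaloisLevelData 𝒢) (h𝒢 : 𝒢.IsCountable)

/-- Two distinct vertices of a level tree fixed by every element of a set `K ⊆ π₁^temp` give a branch at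
the first one fixed by every element of `K` (Lemma 1.8 (ii)(b); abc-iut-w6-d063's lemma, here
for the Galois tower action). [cite: MochizukiSemiAnbd2006, Lem. 1.8(ii) p.20] -/
theorem exists_branch_fixed_of_two_fixed_vertices (K : Set (D.temperedPi h𝒢)) (j : ℕ)
    {y w : (D.tree j).Vertex} (hne : y ≠ w)
    (hy : ∀ k ∈ K, (D.treeAct h𝒢 j k).hom.vertexMap y = y) (hw : ∀ k ∈ K, (D.treeAct h𝒢 j k).hom.vertexMap w = w) :
    ∃ b : (D.tree j).Branch, (D.tree j).abuts b = some y ∧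
      ∀ k ∈ K, (D.treeAct h𝒢 j k).hom.branchMap b = b := by
  classical
  have hT := (D.isTree_tree j).isTree
  let p : (D.tree j).subdivision.Path (Sum.inl y) (Sum.inl w) := (hT.connected (Sum.inl y) (Sum.inl w)).some.toPath
  have hall : ∀ k ∈ K, ∀ z ∈ p.1.support, SemiGraph.nodeMap (D.treeAct h𝒢 j k) z = z := fun k hk =>
    SemiGraph.nodeMap_eq_self_of_isPath hT.isAcyclic (D.treeAct h𝒢 j k) (by simp [hy k hk]) (by simp [hw k hk])
      p.1 p.2
  have h0n : 0 < p.1.length :=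
    SemiGraph.lt_length_of_getVert_ne p.1 (Nat.zero_le _) (by rw [p.1.getVert_zero]; simpa using hne)
  obtain ⟨b, hb, hx1⟩ := SemiGraph.step_vertex p.1 h0n p.1.getVert_zero
  refine ⟨b, hb, fun k hk => ?_⟩
  have h1 := hall k hk (p.1.getVert 1) (p.1.getVert_mem_support 1)
  rw [hx1] at h1
  simpa only [SemiGraph.nodeMap_inr_inr, Sum.inr.injEq] using h1

end GaloisLevelData

variable (p : ℕ) [hp : Fact p.Prime] (n : ℕ → ℕ)

/-- `Thm37Hypotheses 𝒢_θ(p, n)` (re-assembled as in the parent files). [cite: MochizukiSemiAnbd2006, Thm 3.7 p.40] -/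
private theorem thm37θ'' : (thetaRayFreeProP p n).Thm37Hypotheses :=
  thetaRayFreeProP_thm37Hypotheses p n
    (thetaRayFreeProP_isGaloisCountable p (α p) (α_ofAdd_one p) (fun m => θHom p m)
      (fun m => (θ p m).bijective) n)
    (thetaRayFreeProP_isQuasiCoherent p (α p) (α_ofAdd_one p) (fun m => θHom p m)
      (fun m => (θ p m).bijective) n)
    (thetaRayFreeProP_isTotallyElevated_concrete p n)
    (thetaRayFreeProP_isTotallyAloof_concrete p n)
    (thetaRayFreeProP_isTotallyEstranged_concrete p n)

/-- **THE ESCAPING PROCYCLIC COMPACT OF `π₁^temp(𝒢_θ(p,n))` IS THE UNIQUE MAXIMAL COMPACT SUBGROUP ABOVE EACH OF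
ITS POWERS** (see the module docstring): for every schedule `n_k → ∞` there is `c` in the canonical
`π₁^temp(𝒢_θ)` with `C = closure⟨c⟩` compact, in no verticial subgroup, and `K ≤ C` for every compact subgroup
`K ∋ c^{p^m}`. [cite: MochizukiSemiAnbd2006, Thm 3.7(iv) p.41] -/
theorem thetaRayFreeProP_exists_compact_unique_above_powers (hn : Tendsto n atTop atTop)
    (h36 : (thetaRayFreeProP p n).Prop36Hypotheses) :
    ∃ c : ((thetaRayFreeProP p n).temperedPiChart h36).G,
      IsCompact ((Subgroup.zpowers c).topologicalClosure : Set ((thetaRayFreeProP p n).temperedPiChart h36).G) ∧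
      (∀ (v : ℕ) (H : Subgroup ((thetaRayFreeProP p n).temperedPiChart h36).G),
        H ∈ verticialSubgroups ((thetaRayFreeProP p n).temperedPiChart h36) v →
          ¬ (Subgroup.zpowers c).topologicalClosure ≤ H) ∧
      ∀ (m : ℕ) (K : Subgroup ((thetaRayFreeProP p n).temperedPiChart h36).G),
        IsCompact (K : Set ((thetaRayFreeProP p n).temperedPiChart h36).G) → c ^ p ^ m ∈ K →
          K ≤ (Subgroup.zpowers c).topologicalClosure := by
  classical
  haveI : NeZero p := ⟨hp.out.ne_zero⟩
  have h37 : (thetaRayFreeProP p n).Thm37Hypotheses := thm37θ'' p n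
  let Dg : GaloisLevelData (thetaRayFreeProP p n) := (thetaRayFreeProP p n).galoisLevelData h36
  have hc := h36.isCountable
  let Vd := verticialLevelData_temperedPiChart (h36 := h36)
  obtain ⟨P₀⟩ := thetaRay_nonempty_pointSeq_zero (G := Grp p) (E := Multiplicative ℤ_[p]) (up := α p)
    (low := fun k => θα p (n k)) h36
  have hcoin : ∀ d : ℕ, ∃ N : ℕ, ∀ k, N ≤ k →
      ((fun k => θα p (n k)) (k + 1) (ofAdd (1 : ℤ_[p])))⁻¹ * α p (ofAdd 1) ∈ charOpenCore (Grp p) d :=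
    FreeProPRankTwo.hcoin_concrete p n hn
  -- the apartment generators and the escaping element `c`
  obtain ⟨hz, hfin, -⟩ := thetaRay_levelEscape_data (G := Grp p) (E := Multiplicative ℤ_[p]) (up := α p)
    (low := fun k => θα p (n k)) h36 P₀ (ofAdd (1 : ℤ_[p])) hcoin
  set z : ℕ → Dg.temperedPi hc := fun k =>
    (rayPointSeq (D := Dg) thetaRay_ham thetaRay_hap thetaRay_hmp P₀ (k + 1)).decompHom
      ((thetaRayFreeProP p n).brHom (k, true) (k + 1) (thetaRay_hap k) (ofAdd (1 : ℤ_[p]))) with hzdef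
  obtain ⟨c, hcN⟩ := Dg.exists_forall_eventually_projAut_eq hc z hz
  choose Nc hN using hcN
  have hN' : ∀ j k, Nc j ≤ k → Dg.proj hc j c = Dg.proj hc j (z k) := hN
  have hford : ∀ j, IsOfFinOrder (Dg.projAut hc j c) := fun j => by
    rw [hN j (Nc j) le_rfl]; exact hfin j (Nc j)
  have hC : IsCompact ((Subgroup.zpowers c).topologicalClosure : Set (Dg.temperedPi hc)) :=
    Dg.isCompact_topologicalClosure_zpowers hc c hford
  have hcC : c ∈ (Subgroup.zpowers c).topologicalClosure :=
    Subgroup.le_topologicalClosure _ (Subgroup.mem_zpowers c)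
  -- escape of the powers, monotone in the level
  have hesc : ∀ (m B : ℕ), ∃ j : ℕ, ∀ N, j ≤ N → ∀ y : (Dg.tree N).Vertex,
      (Dg.treeAct hc N (c ^ p ^ m)).hom.vertexMap y = y → B ≤ (Dg.treeProj N).vertexMap y := by
    intro m B
    obtain ⟨j, hj⟩ := thetaRayFreeProP_heightEscape_pow p n hn h37 P₀ c (fun j => ⟨Nc j, hN j⟩) m B
    refine ⟨j, fun N hjN y hy => ?_⟩
    have h1 : (Vd.act j (c ^ p ^ m)).hom.vertexMap ((Vd.trans hjN).vertexMap y) = (Vd.trans hjN).vertexMap y := by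
      rw [← Vd.trans_act_vertexMap]
      exact congrArg _ hy
    have h2 := hj _ h1
    have h3 : (Vd.proj j).vertexMap ((Vd.trans hjN).vertexMap y) = (Vd.proj N).vertexMap y := by
      have e := congrArg (fun φ => SemiGraph.Hom.vertexMap φ y) (Vd.trans_over hjN)
      simpa only [SemiGraph.comp_vertexMap, Function.comp_apply] using e
    rw [h3] at h2
    exact h2
  refine ⟨c, hC, ?_, ?_⟩
  · -- `C` lies in no verticial subgroup: the fixed points of `c` escape
    intro v H hH hCH
    obtain ⟨hheight⟩ : Nonempty (∀ B : ℕ, ∃ j : Vd.J, ∀ y : (Vd.tree j).Vertex,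
        (Vd.act j c).hom.vertexMap y = y → B ≤ (fun v : ℕ => v) ((Vd.proj j).vertexMap y)) := by
      refine ⟨fun B => ?_⟩
      obtain ⟨j, hj⟩ := hesc 0 B
      refine ⟨j, fun y hy => hj j le_rfl y ?_⟩
      rw [pow_zero, pow_one]
      exact hy
    have hescC := Vd.escaping_of_height_unbounded ((Subgroup.zpowers c).topologicalClosure) c hcC
      (fun v : ℕ => v) hheight
    exact Vd.not_exists_verticial_of_le_of_escaping _ _ le_rfl hescC ⟨v, H, hH, hCH⟩
  · -- the main clause
    intro m K hK hxK g hg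
    apply Dg.mem_topologicalClosure_of_forall_proj hc
    -- levels where `ρ_N(c)^{p^m} ≠ 1`
    obtain ⟨j₁, hj₁⟩ := hesc m 1
    have hne : ∀ N, j₁ ≤ N → (Dg.proj hc N c) ^ p ^ m ≠ 1 := by
      intro N hN1 h1
      have hfix : (Dg.treeAct hc N (c ^ p ^ m)).hom.vertexMap (P₀.vertex N) = P₀.vertex N := by
        rw [Dg.treeAct_apply hc, map_pow, h1, map_one]; rfl
      have h2 := hj₁ N hN1 _ hfix
      have e0 : (Dg.treeProj N).vertexMap (P₀.vertex N) = (0 : ℕ) := P₀.treeProj_vertexMap_vertex N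
      rw [e0] at h2
      exact Nat.not_succ_le_zero 0 h2
    -- it suffices to treat the large levels
    suffices hlarge : ∀ N, j₁ ≤ N → Dg.proj hc N g ∈ Subgroup.zpowers (Dg.proj hc N c) by
      intro N
      obtain ⟨k, hk⟩ := Subgroup.mem_zpowers_iff.mp (hlarge (max j₁ N) (le_max_left _ _))
      refine ⟨c ^ k, ⟨k, rfl⟩, ?_⟩
      rw [map_zpow, ← Dg.mapLE_proj hc (le_max_right j₁ N) c, ← map_zpow, hk, Dg.mapLE_proj]
    intro n₀ hn₀
    -- level-`n₀` data: the core `G(d)` acting trivially, the far twists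
    haveI : Finite (((Dg.S n₀).SV (0 : ℕ)).obj.V) := ((thetaRayFreeProP p n).galoisLevelData_isFinite h36 n₀).finite_V (0 : ℕ)
    set d : ℕ := Nat.card (((Dg.S n₀).SV (0 : ℕ)).obj.V) with hd
    have hV : ∀ (w : ℕ) (P : Dg.PointSeq hc w) (v : Grp p), v ∈ charOpenCore (Grp p) d → P.gal n₀ v = 1 := by
      intro w P v hv
      haveI : Finite (((Dg.S n₀).SV w).obj.V) := ((thetaRayFreeProP p n).galoisLevelData_isFinite h36 n₀).finite_V w
      apply P.gal_eq_one_of_mem_charOpenCore n₀ v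
      rw [thetaRay_card_SV_eq (G := Grp p) (E := Multiplicative ℤ_[p]) (up := α p) (low := fun k => θα p (n k))
        (Dg.S n₀) w]
      exact hv
    haveI : (charOpenCore (Grp p) d).Normal := FreeProPRankTwo.normal_charOpenCore p d
    obtain ⟨τ, hτ⟩ := FreeProPRankTwo.exists_forall_θ_mul_inv_mem p (charOpenCore (Grp p) d)
      (FreeProPRankTwo.isOpen_charOpenCore p d)
    obtain ⟨k₁, hk₁⟩ : ∃ k₁ : ℕ, ∀ k, k₁ ≤ k → τ ≤ n k :=
      Filter.eventually_atTop.mp (Filter.tendsto_atTop.mp hn τ)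
    have htwist : ∀ k, k₁ ≤ k → ∀ g : Grp p, θ p (n k) g * g⁻¹ ∈ charOpenCore (Grp p) d :=
      fun k hk g => hτ (n k) (hk₁ k hk) g
    -- the far bound and the escape level for it
    obtain ⟨jF, hjF⟩ := hesc m (max k₁ (Nc n₀ + 1))
    -- the frame-shift level
    have hΛ : IsCompact {l : Multiplicative ℤ_[p] | ‖(p : ℤ_[p]) ^ m‖ ≤ ‖l.toAdd‖} :=
      (isClosed_le continuous_const (continuous_norm.comp continuous_toAdd)).isCompact
    have hΛ1 : (1 : Multiplicative ℤ_[p]) ∉ {l : Multiplicative ℤ_[p] | ‖(p : ℤ_[p]) ^ m‖ ≤ ‖l.toAdd‖} := by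
      simp only [Set.mem_setOf_eq, toAdd_one, norm_zero, not_le]
      exact norm_pos_iff.mpr (pow_ne_zero m (Nat.cast_ne_zero.mpr hp.out.ne_zero))
    obtain ⟨N₀, hN₀⟩ := thetaRayFreeProP_frame_shift p n hΛ hΛ1 (charOpenCore (Grp p) d)
      (FreeProPRankTwo.isOpen_charOpenCore p d) h36
    -- (♦) at every deep level
    have hdiamond : ∀ N' (hnN : n₀ ≤ N'), N₀ ≤ N' → jF ≤ N' → ∀ yy : (Dg.tree N').Vertex,
        (Dg.treeAct hc N' (c ^ p ^ m)).hom.vertexMap yy = yy →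
        (Dg.treeAct hc n₀ c).hom.vertexMap ((Dg.treeTrans hnN).vertexMap yy) = (Dg.treeTrans hnN).vertexMap yy := by
      intro N' hnN hN₀' hjF' yy hyy
      refine thetaRayFreeProP_deepFixed_proj_fixed p n h36 P₀ c Nc hN' m N' hnN (hne n₀ hn₀) d hV k₁ htwist
        (fun w P b₁ b₂ hb₁ hb₂ f₁ f₂ y₁ y₂ k k₂ hk₂ hy₁ hy₂ heq =>
          hN₀ N' hN₀' w P b₁ b₂ hb₁ hb₂ f₁ f₂ y₁ y₂ k k₂ hk₂ hy₁ hy₂ heq)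
        (fun y hy => ⟨le_trans (le_max_left _ _) (hjF N' hjF' y hy), le_trans (le_max_right _ _) (hjF N' hjF' y hy)⟩)
        yy hyy
    -- `K` fixes vertices; all `K`-fixed vertices are `x`-fixed
    have hKfixV : ∀ j, ∃ y : (Dg.tree j).Vertex, ∀ k ∈ K, (Dg.treeAct hc j k).hom.vertexMap y = y := by
      intro j
      obtain ⟨y, hy⟩ := SemiGraph.exists_fixed_vertex_of_isCompact_over K hK (Vd.isTree j) (Vd.vertex j)
        (Vd.proj j) (Vd.act j) (Vd.isOpen_ker j) (Vd.act_over j)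
      exact ⟨y, fun k hk => hy ⟨k, hk⟩⟩
    -- the first deep level and a `K`-fixed vertex there
    set N₁ : ℕ := max (max N₀ jF) n₀ with hN₁
    have hn₀N₁ : n₀ ≤ N₁ := le_max_right _ _
    obtain ⟨y₂, hy₂⟩ := hKfixV N₁
    set w := (Dg.treeTrans hn₀N₁).vertexMap y₂ with hw
    -- a deeper level where the `x`-fixed vertices are higher than `w`
    obtain ⟨jB, hjB⟩ := hesc m (Nat.succ ((Dg.treeProj n₀).vertexMap w))
    set N₂ : ℕ := max N₁ jB with hN₂
    have hn₀N₂ : n₀ ≤ N₂ := hn₀N₁.trans (le_max_left _ _)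
    obtain ⟨y₃, hy₃⟩ := hKfixV N₂
    set w' := (Dg.treeTrans hn₀N₂).vertexMap y₃ with hw'
    -- `w ≠ w'` (heights differ)
    have hww' : w ≠ w' := by
      intro h
      have h1 : (Dg.treeProj n₀).vertexMap w' = (Dg.treeProj N₂).vertexMap y₃ := by
        have e := congrArg (fun φ => SemiGraph.Hom.vertexMap φ y₃) (Dg.treeTrans_over hn₀N₂)
        simpa only [SemiGraph.comp_vertexMap, Function.comp_apply] using e
      have h2 := hjB N₂ (le_max_right _ _) y₃ (hy₃ _ hxK)
      rw [← h1, ← h] at h2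
      exact Nat.not_succ_le_self _ h2
    -- `K` and `c` fix `w` and `w'`
    have hKw : ∀ k ∈ K, (Dg.treeAct hc n₀ k).hom.vertexMap w = w := fun k hk => by
      have h1 := Vd.trans_act_vertexMap hn₀N₁ k y₂
      change (Dg.treeTrans hn₀N₁).vertexMap ((Dg.treeAct hc N₁ k).hom.vertexMap y₂) =
        (Dg.treeAct hc n₀ k).hom.vertexMap ((Dg.treeTrans hn₀N₁).vertexMap y₂) at h1
      rw [hy₂ k hk] at h1
      exact h1.symm
    have hKw' : ∀ k ∈ K, (Dg.treeAct hc n₀ k).hom.vertexMap w' = w' := fun k hk => by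
      have h1 := Vd.trans_act_vertexMap hn₀N₂ k y₃
      change (Dg.treeTrans hn₀N₂).vertexMap ((Dg.treeAct hc N₂ k).hom.vertexMap y₃) =
        (Dg.treeAct hc n₀ k).hom.vertexMap ((Dg.treeTrans hn₀N₂).vertexMap y₃) at h1
      rw [hy₃ k hk] at h1
      exact h1.symm
    have hcw : (Dg.treeAct hc n₀ c).hom.vertexMap w = w :=
      hdiamond N₁ hn₀N₁ ((le_max_left _ _).trans (le_max_left _ _)) ((le_max_right _ _).trans (le_max_left _ _))
        y₂ (hy₂ _ hxK)
    have hcw' : (Dg.treeAct hc n₀ c).hom.vertexMap w' = w' :=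
      hdiamond N₂ hn₀N₂ (((le_max_left _ _).trans (le_max_left _ _)).trans (le_max_left _ _))
        (((le_max_right _ _).trans (le_max_left _ _)).trans (le_max_left _ _)) y₃ (hy₃ _ hxK)
    -- the set `K ∪ {c}` fixes both, hence a common fixed branch `β` at `w`
    obtain ⟨β, hβw, hβfix⟩ := Dg.exists_branch_fixed_of_two_fixed_vertices hc (insert c (K : Set ((thetaRayFreeProP p n).temperedPiChart h36).G))
      n₀ hww' (Set.forall_mem_insert.mpr ⟨hcw, fun k hk => hKw k hk⟩)
      (Set.forall_mem_insert.mpr ⟨hcw', fun k hk => hKw' k hk⟩)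
    -- SQUEEZE in cover coordinates (as in EXOTIC-IS-C)
    have hcover := Dg.cover_sameComponent hc
    have htrans := Dg.cover_htrans hc
    set β₀ := (Dg.treeIso hc n₀).inv.branchMap β with hβ₀
    have hβeq : β = (Dg.treeIso hc n₀).hom.branchMap β₀ := (Dg.treeIso_hom_branchMap_inv hc n₀ β).symm
    set b : ℕ × Bool := β₀.1.1 with hbdef
    set k : ℕ := (Dg.treeProj n₀).vertexMap w with hkdef
    have hb : (thetaRayFreeProP p n).graph.abuts b = some k := by
      have h1 := (Dg.treeProj n₀).abuts_branchMap β w hβw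
      rwa [hβeq, Dg.treeProj_branchMap_treeIso hc] at h1
    -- `w` is far at level `n₀`
    have hkfar : Nc n₀ + 1 ≤ k := by
      have h1 : (Dg.treeProj n₀).vertexMap w = (Dg.treeProj N₁).vertexMap y₂ := by
        have e := congrArg (fun φ => SemiGraph.Hom.vertexMap φ y₂) (Dg.treeTrans_over hn₀N₁)
        simpa only [SemiGraph.comp_vertexMap, Function.comp_apply] using e
      rw [hkdef, h1]
      exact le_trans (le_max_right _ _) (hjF N₁ ((le_max_right _ _).trans (le_max_left _ _)) y₂ (hy₂ _ hxK))
    -- every element of `K ∪ {c}` fixes `β₀`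
    have hKfix : ∀ g' ∈ insert c (K : Set ((thetaRayFreeProP p n).temperedPiChart h36).G),
        (CovObj.orbitGraphMap (Dg.proj hc n₀ g').hom).branchMap β₀ = β₀ := by
      intro g' hg'
      have hfixβ : (Dg.treeAct hc n₀ g').hom.branchMap β = β := hβfix g' hg'
      rw [Dg.treeAct_apply hc, hβeq, Dg.galTreeAct_branchMap_treeIso hc] at hfixβ
      have h2 := congrArg (Dg.treeIso hc n₀).inv.branchMap hfixβ
      rwa [Dg.treeIso_inv_branchMap_hom hc, Dg.treeIso_inv_branchMap_hom hc] at h2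
    obtain ⟨yv, hyβ⟩ := (Dg.cover hc n₀).exists_eq_brOf b hb β₀ rfl
    rw [hyβ] at hKfix
    -- the cyclic branch stabiliser `Z = ⟨ψ_{yv}(b_* 1)⟩` and single-element membership
    set ε := (Dg.cover hc n₀).ptHom (hcover n₀) (htrans n₀) yv
      ((thetaRayFreeProP p n).brHom b k hb (ofAdd (1 : ℤ_[p]))) with hε
    have hmemZ : ∀ q : Aut (Dg.cover hc n₀),
        (CovObj.orbitGraphMap q.hom).branchMap ((Dg.cover hc n₀).brOf b hb yv) = (Dg.cover hc n₀).brOf b hb yv →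
        q ∈ Subgroup.zpowers ε := by
      intro q hq
      obtain ⟨σ, hσ⟩ := (Dg.cover hc n₀).exists_aut_fV_eq (hcover n₀) (htrans n₀) yv yv
      rw [← hσ] at hq
      obtain ⟨a, ha, rfl⟩ := Subgroup.mem_map.mp (((Dg.cover hc n₀).stab_brOf_iff (hcover n₀) (htrans n₀) yv σ q).mp hq)
      have hσ1 : σ = 1 := (Dg.cover hc n₀).aut_eq_of_fV_eq (hcover n₀) yv (by rw [hσ]; rfl)
      subst hσ1
      rw [(Dg.cover hc n₀).map_ptHom_branchSubgroup_eq_zpowers (hcover n₀) (htrans n₀) hb yv (ofAdd (1 : ℤ_[p]))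
        PadicInt.topologicalClosure_zpowers_ofAdd_one, ← hε] at ha
      simpa using ha
    -- the order of the branch generator at `yv` is the order of `ρ_{n₀}(c)` (read in `Aut (𝒢_{∞,n₀})`)
    set γ : Aut (Dg.cover hc n₀) := Dg.projAut hc n₀ c with hγ
    have hord : orderOf ε = orderOf γ := by
      obtain ⟨Py, hPy, -⟩ := Dg.exists_pointSeq_pt_eq hc n₀ yv
      have h1 : Py.gal n₀ ((thetaRayFreeProP p n).brHom b k hb (ofAdd (1 : ℤ_[p]))) = ε := by
        rw [hε, ← hPy]
        exact (Py.eq_gal n₀ _ _ ((Dg.cover hc n₀).ptHom_apply (hcover n₀) (htrans n₀) (Py.pt n₀) _)).symm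
      rw [← h1]
      exact thetaRay_orderOf_gal_brHom_eq_of_far (G := Grp p) (E := Multiplicative ℤ_[p]) (up := α p)
        (low := fun k => θα p (n k)) h36 P₀ (ofAdd (1 : ℤ_[p])) c Nc hN' n₀ b k hb hkfar Py
    -- the squeeze: `⟨ρ_{n₀}(c)⟩ = Z ∋ ρ_{n₀}(g)`
    have hcZ : γ ∈ Subgroup.zpowers ε := hmemZ γ (hKfix c (Set.mem_insert _ _))
    have hgZ : Dg.projAut hc n₀ g ∈ Subgroup.zpowers ε := hmemZ _ (hKfix g (Set.mem_insert_of_mem _ hg))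
    have hfinε : IsOfFinOrder ε := by
      rw [← orderOf_pos_iff, hord]
      exact (hford n₀).orderOf_pos
    haveI : Finite (Subgroup.zpowers ε) := hfinε.finite_zpowers
    have heq : Subgroup.zpowers γ = Subgroup.zpowers ε :=
      Subgroup.eq_of_le_of_card_ge ((Subgroup.zpowers_le).mpr hcZ)
        (by rw [Nat.card_zpowers, Nat.card_zpowers, hord])
    rw [← heq] at hgZ
    exact hgZ

end ProfiniteSemiGraph

end Literature.AnabelianGeometry.SemiGraphs

end
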